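import Literature.Analysis.FluidPDE.LerayEnstrophyAPriori
import Literature.Analysis.FluidPDE.ForcedFourierForceFamily
import Literature.Analysis.FluidPDE.RapidDecayLemmas
import Literature.Analysis.FluidPDE.TaoEnergyLocalisationProofs
import HarnessLib

/-!
# The enstrophy a priori bound WITH FORCING: lifespan `(‖∇u₀‖₂ + ‖∇f‖_{L¹_t L²_x})⁴ T ≤ c ν³`
# (Tao 2013, Thm. 5.4 (ii), the `X¹` bound `‖u‖_{X¹} ≲ ‖u₀‖_{H¹} + ‖f‖_{L¹_t H¹_x}`, gradient part;
# Robinson–Rodrigo–Sadowski 2016, (6.6)–(6.10) and Cor. 6.9 with a force)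

Analysis/FluidPDE proof file (cell `pub/ns-blowup`, seat `ns-blowup-lit` g11; no definitions, no
named facts). It is the FORCED twin of the tree's `LerayEnstrophyAPriori.lean`
(`exists_enstrophy_cubic_ineq`, `exists_leray_enstrophy_apriori`), the first brick of the forced
twin of `TaoH1AlmostRegularAssembly.lean` (the discharge chain
`tao2011_smooth_local_existence_forced → tao2011_forced_H1_local_almost_regular`).

For a classical solution `(u, p)` of the Navier–Stokes system WITH FORCE `f` on a closed slab
`[0, T] × ℝ³` in the `L²`-Sobolev class of Tao's smooth `H¹` theory (`u, ∂ₜu, p ∈ L^∞_t H^k_x`) and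
a force `f` jointly smooth on the slab with Tao's uniform Schwartz bounds there
(`IsSmoothSpaceTimeOn (Icc 0 T) f`, `HasUniformRapidDecayOn (Icc 0 T) f` — the force class of the
forced local existence fact `tao2011_smooth_local_existence_forced`), writing
`G(t) = ∫ |∇u(t)|²`, `G_f(t) = ∫ |∇f(t)|²` (Frobenius norms):

* `exists_enstrophy_cubic_ineq_forced` — the cubic enstrophy inequality with dissipation and work
  term, integrated in time:
  `G(b) ≤ G(0) + ∫₀ᵇ (κ ν⁻³ G³ + 2 √G √G_f)` (`b ∈ [0, T]`) and
  `ν ∫₀ᵀ∫ ‖Δu‖² ≤ G(0) + ∫₀ᵀ (κ ν⁻³ G³ + 2 √G √G_f)`;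
* `exists_leray_enstrophy_apriori_forced` — the bootstrap: with absolute constants `c, K > 0`, if
  `∫|∇u(0)|² ≤ A`, `∫₀ᵀ √G_f ≤ B` and `(√A + B)⁴ T ≤ c ν³`, then
  `∫ |∇u(t)|² ≤ K (√A + B)²` for all `t ∈ [0, T]` and `ν ∫₀ᵀ ∫ ‖D²u‖² ≤ K (√A + B)²`.

## The argument (RRS (6.6)–(6.10) with the work term; Tao 2013, proof of Thm. 5.4 (ii))

The forced momentum equation `∂ₜu + (u·∇)u = νΔu − ∇p + f` is the unforced one for the modified
time derivative `W := ∂ₜu − f`: `W + (u·∇)u = νΔu − ∇p`. The tree's slice lemma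
`exists_slice_dissipative` is stated for an ABSTRACT `W` with exactly this equation, so it gives
`∫ Σᵢ⟪∂ᵢu, ∂ᵢW⟫ ≤ −(ν/2)‖Δu‖²₂ + C ν⁻³ ‖u‖⁴_{L⁶} ∫|∇u|²` verbatim; the enstrophy balance
`G(b) = G(0) + ∫₀ᵇ 2Σᵢ∫⟪∂ᵢu, ∂ᵢ∂ₜu⟫` (`IsSmoothSpaceTimeOn.enstrophy_balance`) then carries the extra
work term `2∫Σᵢ⟪∂ᵢu, ∂ᵢf⟫ ≤ 2 √G √G_f` (Cauchy–Schwarz, pointwise in the Frobenius inner product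
and in `L²`). The bootstrap: with `M = √A + B`, as long as `G ≤ 9M²` on `[0, b]`,
the inequality is LINEAR, `G(t) ≤ G(0) + ∫₀ᵗ (81 κ ν⁻³ M⁴ G + 6 M √G_f)`, and the tree's
continuity method `bootstrap_gronwall_integral` (`TaoEnstrophyContinuity.lean`) closes as soon as
`e^{81 κ ν⁻³ M⁴ T} (A + 6 M B) ≤ (9/8) · 7 M² < 9 M²`, i.e. for `729 κ M⁴ T ≤ ν³`; the degenerate case
`M = 0` is the limit `δ → 0` of the bound with `A = δ`. The dissipation bound follows with the
Hessian–Laplacian conversion `∫‖D²u‖² ≤ 27 ∫‖Δu‖²` (`lintegral_iteratedFDeriv_two_le_laplacian`).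

## Mathlib / tree search

No Navier–Stokes material in Mathlib. Tree: the unforced file `LerayEnstrophyAPriori.lean` (all its
slice / Hessian lemmas are reused by name), `IsSmoothSpaceTimeOn.enstrophy_balance`
(`SerrinEnstrophyGronwall.lean`), the slab force-class lemmas
`IsSmoothSpaceTimeOn.norm_iteratedFDeriv_slice_le_Icc` (`ForcedFourierForceData.lean`),
`HasUniformRapidDecayOn.timeDerivWithin` (`ForcedFourierForceFamily.lean`),
`HasUniformRapidDecayOn.norm_iteratedFDerivWithin_le_rpow` (`RapidDecayLemmas.lean`),
`integral_mul_le_sqrt_mul_sqrt` (`TaoEnergyLocalisationProofs.lean`), `bootstrap_gronwall_integral`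
(`TaoEnstrophyContinuity.lean`). `lean search
'enstrophy_apriori_forced|cubic_ineq_forced'`: no hits before this file; the forced Serrin-class
Grönwall `enstrophy_le_of_serrin_forced_uniform` (`SerrinEnstrophyGronwallForced.lean`) is a
different (linear, Serrin-weighted) inequality.

## References

* T. Tao, *Localisation and compactness properties of the Navier–Stokes global regularity
  problem*, Anal. PDE 6 (2013) 25–107 = arXiv:1108.1165, Thm. 5.4 (ii) (arXiv Thm. 31, p. 18:
  "`‖u‖_{X¹([0,T] × ℝ³)} ≲ ‖u₀‖_{H¹_x} + ‖f‖_{L¹_t H¹_x}`" under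
  "`(‖u₀‖_{H¹_x(ℝ³)} + ‖f‖_{L¹_t H¹_x(ℝ³)})⁴ T ≤ c`"). [Tao2011]
* J. C. Robinson, J. L. Rodrigo, W. Sadowski, *The Three-Dimensional Navier–Stokes Equations*,
  CUP 2016, proof of Thm. 6.8, (6.6)–(6.10), Cor. 6.9 (PDF pp. 103–105). [RobinsonRodrigoSadowski2016]
-/

noncomputable section

open MeasureTheory Set Function Filter Topology InnerProductSpace
open scoped ENNReal NNReal ContDiff RealInnerProductSpace Laplacian

namespace Literature.Analysis.FluidPDE

/-! ### Slab Schwartz forces have all slice Sobolev norms bounded uniformly on the slab -/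

section SlabForce

variable {X : Type*} [NormedAddCommGroup X] [InnerProductSpace ℝ X] [FiniteDimensional ℝ X]
  [MeasurableSpace X] [BorelSpace X] {F : Type*} [NormedAddCommGroup F] [NormedSpace ℝ F]
  {μ : Measure X} [μ.IsAddHaarMeasure] {T : ℝ} {f : ℝ → X → F}

/-- **`L^∞_t H^k_x` bounds for a Schwartz-on-slab force** (Tao 2013, §1 p. 3: Schwartz data are
`H¹` data; here every order): for `f` jointly smooth on `[0, T] × X` (`T > 0`) with the uniform
Schwartz bounds `(1 + ‖x‖)^K ‖Dⁿ(uncurry f)(t, x)‖ ≤ C_{n,K}` there, each `‖Dᵐ(f t)‖²_{L²}` is bounded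
by ONE constant for all `t ∈ [0, T]` (weight `K = dim X + 1` and Mathlib's
`finite_integral_one_add_norm`; slab twin of the tree's
`HasRapidSpaceTimeDecay.exists_lintegral_iteratedFDeriv_slice_sq_le_all`). [cite: Tao2011, §1 p. 3] -/
theorem HasUniformRapidDecayOn.exists_lintegral_iteratedFDeriv_slice_sq_le_Icc
    (hd : HasUniformRapidDecayOn (Icc 0 T) f) (hf : IsSmoothSpaceTimeOn (Icc 0 T) f) (hT : 0 < T)
    (m : ℕ) : ∃ C : ℝ≥0, ∀ t ∈ Icc 0 T, ∫⁻ x, ‖iteratedFDeriv ℝ m (f t) x‖ₑ ^ 2 ∂μ ≤ C := by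
  set K : ℕ := Module.finrank ℝ X + 1 with hK
  have hr : (Module.finrank ℝ X : ℝ) < (K : ℝ) + K := by
    rw [hK]; push_cast; linarith [(Module.finrank ℝ X).cast_nonneg (α := ℝ)]
  set I : ℝ≥0∞ := ∫⁻ x, ENNReal.ofReal ((1 + ‖x‖) ^ (-((K : ℝ) + K))) ∂μ with hI
  have hItop : I < ⊤ := finite_integral_one_add_norm hr
  obtain ⟨C, hC0, hC⟩ := hd.norm_iteratedFDerivWithin_le_rpow m K
  have hB : ENNReal.ofReal (C ^ 2) * I < ⊤ := ENNReal.mul_lt_top ENNReal.ofReal_lt_top hItop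
  refine ⟨(ENNReal.ofReal (C ^ 2) * I).toNNReal, fun t ht => ?_⟩
  rw [ENNReal.coe_toNNReal hB.ne]
  have hg : ∀ x, ‖iteratedFDeriv ℝ m (f t) x‖ ≤ C * (1 + ‖x‖) ^ (-(K : ℝ)) := fun x =>
    (hf.norm_iteratedFDeriv_slice_le_Icc hT m ht x).trans (hC t ht x)
  have hpt : ∀ x : X, ‖iteratedFDeriv ℝ m (f t) x‖ₑ ^ 2 ≤
      ENNReal.ofReal (C ^ 2) * ENNReal.ofReal ((1 + ‖x‖) ^ (-((K : ℝ) + K))) := by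
    intro x
    have hx : 0 < 1 + ‖x‖ := by positivity
    have h2 : ‖iteratedFDeriv ℝ m (f t) x‖ ^ 2 ≤ C ^ 2 * (1 + ‖x‖) ^ (-((K : ℝ) + K)) := by
      calc ‖iteratedFDeriv ℝ m (f t) x‖ ^ 2 ≤ (C * (1 + ‖x‖) ^ (-(K : ℝ))) ^ 2 :=
            pow_le_pow_left₀ (norm_nonneg _) (hg x) 2
        _ = C ^ 2 * ((1 + ‖x‖) ^ (-(K : ℝ)) * (1 + ‖x‖) ^ (-(K : ℝ))) := by ring
        _ = C ^ 2 * (1 + ‖x‖) ^ (-((K : ℝ) + K)) := by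
            rw [← Real.rpow_add hx]; congr 1; ring_nf
    rw [← ofReal_norm, ← ENNReal.ofReal_pow (norm_nonneg _), ← ENNReal.ofReal_mul (sq_nonneg _)]
    exact ENNReal.ofReal_le_ofReal h2
  calc ∫⁻ x, ‖iteratedFDeriv ℝ m (f t) x‖ₑ ^ 2 ∂μ
      ≤ ∫⁻ x, ENNReal.ofReal (C ^ 2) * ENNReal.ofReal ((1 + ‖x‖) ^ (-((K : ℝ) + K))) ∂μ :=
        lintegral_mono hpt
    _ = ENNReal.ofReal (C ^ 2) * I := by
        rw [hI, lintegral_const_mul' _ _ ENNReal.ofReal_ne_top]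

/-- The slices of a Schwartz-on-slab force and of its slab time derivative have bounded `L²`
Sobolev norms on the slab (`HasBoundedSobolevNormsOn`-shaped statement, every order), specialised
to `ℝ³ → ℝ³`. [cite: Tao2011, §1 p. 3] -/
theorem HasUniformRapidDecayOn.hasBoundedSobolevNormsOn_Icc {T : ℝ}
    {f : ℝ → EuclideanSpace ℝ (Fin 3) → EuclideanSpace ℝ (Fin 3)}
    (hd : HasUniformRapidDecayOn (Icc 0 T) f) (hf : IsSmoothSpaceTimeOn (Icc 0 T) f) (hT : 0 < T) :
    HasBoundedSobolevNormsOn (Icc 0 T) f ∧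
      HasBoundedSobolevNormsOn (Icc 0 T) (FluidPDE.timeDerivWithin (Icc 0 T) f) := by
  have hU : UniqueDiffOn ℝ (Icc 0 T) := uniqueDiffOn_Icc hT
  exact ⟨fun m => hd.exists_lintegral_iteratedFDeriv_slice_sq_le_Icc (μ := volume) hf hT m,
    fun m => (hd.timeDerivWithin hf hU).exists_lintegral_iteratedFDeriv_slice_sq_le_Icc (μ := volume)
      (hf.timeDerivWithin hU) hT m⟩

end SlabForce

/-! ### The work term of the enstrophy balance: `∫ Σᵢ ⟪∂ᵢv, ∂ᵢg⟫ ≤ ‖∇v‖₂ ‖∇g‖₂` -/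

section Work

/-- Finite Cauchy–Schwarz for a sum of inner products: `Σᵢ ⟪aᵢ, bᵢ⟫ ≤ √(Σᵢ‖aᵢ‖²) √(Σᵢ‖bᵢ‖²)`.
[folklore] -/
private theorem sum_inner_le_sqrt_mul_sqrt {ι : Type*} (s : Finset ι)
    (a b : ι → EuclideanSpace ℝ (Fin 3)) :
    ∑ i ∈ s, ⟪a i, b i⟫ ≤ Real.sqrt (∑ i ∈ s, ‖a i‖ ^ 2) * Real.sqrt (∑ i ∈ s, ‖b i‖ ^ 2) := by
  have h1 : ∑ i ∈ s, ⟪a i, b i⟫ ≤ ∑ i ∈ s, ‖a i‖ * ‖b i‖ :=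
    Finset.sum_le_sum fun i _ => real_inner_le_norm _ _
  have h0 : 0 ≤ ∑ i ∈ s, ‖a i‖ * ‖b i‖ :=
    Finset.sum_nonneg fun i _ => mul_nonneg (norm_nonneg _) (norm_nonneg _)
  have h2 : (∑ i ∈ s, ‖a i‖ * ‖b i‖) ^ 2 ≤ (∑ i ∈ s, ‖a i‖ ^ 2) * ∑ i ∈ s, ‖b i‖ ^ 2 :=
    Finset.sum_mul_sq_le_sq_mul_sq s _ _
  have h3 : ∑ i ∈ s, ‖a i‖ * ‖b i‖ ≤
      Real.sqrt (∑ i ∈ s, ‖a i‖ ^ 2) * Real.sqrt (∑ i ∈ s, ‖b i‖ ^ 2) := by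
    rw [← Real.sqrt_mul (Finset.sum_nonneg fun i _ => sq_nonneg _), ← Real.sqrt_sq h0]
    exact Real.sqrt_le_sqrt h2
  exact h1.trans h3

/-- Pointwise bound of a sum of inner products by the squared norms:
`|Σᵢ ⟪aᵢ, bᵢ⟫| ≤ (Σᵢ‖aᵢ‖² + Σᵢ‖bᵢ‖²)/2`. [folklore] -/
private theorem abs_sum_inner_le_half_add {ι : Type*} (s : Finset ι)
    (a b : ι → EuclideanSpace ℝ (Fin 3)) :
    |∑ i ∈ s, ⟪a i, b i⟫| ≤ ((∑ i ∈ s, ‖a i‖ ^ 2) + ∑ i ∈ s, ‖b i‖ ^ 2) / 2 := by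
  refine (Finset.abs_sum_le_sum_abs _ _).trans ?_
  rw [← Finset.sum_add_distrib, Finset.sum_div]
  refine Finset.sum_le_sum fun i _ => ?_
  have h := abs_real_inner_le_norm (a i) (b i)
  nlinarith [sq_nonneg (‖a i‖ - ‖b i‖), norm_nonneg (a i), norm_nonneg (b i)]

/-- **The work term of the enstrophy balance** (Tao 2013, proof of Thm. 5.4 (ii), the term
`‖f‖_{L¹_t H¹_x}`; Robinson–Rodrigo–Sadowski 2016, (6.6) with a force): for `C¹` fields
`v, g : ℝ³ → ℝ³` with `Dv, Dg ∈ L²`, the density `Σᵢ ⟪∂ᵢv, ∂ᵢg⟫` is integrable and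
`∫ Σᵢ ⟪∂ᵢv, ∂ᵢg⟫ ≤ √(∫|∇v|²) · √(∫|∇g|²)` (Cauchy–Schwarz pointwise in the Frobenius inner
product and in `L²`). [cite: Tao2011, Thm. 5.4 (ii) (arXiv Thm. 31, proof)] -/
theorem integral_sum_inner_fderiv_le_sqrt_mul_sqrt
    {v g : EuclideanSpace ℝ (Fin 3) → EuclideanSpace ℝ (Fin 3)}
    (hv : ContDiff ℝ 1 v) (hg : ContDiff ℝ 1 g)
    (hv1 : ∫⁻ x, ‖iteratedFDeriv ℝ 1 v x‖ₑ ^ 2 < ⊤) (hg1 : ∫⁻ x, ‖iteratedFDeriv ℝ 1 g x‖ₑ ^ 2 < ⊤) :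
    Integrable (fun x => ∑ i, ⟪fderiv ℝ v x (EuclideanSpace.basisFun (Fin 3) ℝ i),
        fderiv ℝ g x (EuclideanSpace.basisFun (Fin 3) ℝ i)⟫) volume ∧
      ∫ x, ∑ i, ⟪fderiv ℝ v x (EuclideanSpace.basisFun (Fin 3) ℝ i),
          fderiv ℝ g x (EuclideanSpace.basisFun (Fin 3) ℝ i)⟫ ≤
        Real.sqrt (∫ x, frobeniusNormSq (fderiv ℝ v x)) *
          Real.sqrt (∫ x, frobeniusNormSq (fderiv ℝ g x)) := by
  set e := EuclideanSpace.basisFun (Fin 3) ℝ with he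
  -- continuity
  have cDv : Continuous fun x => fderiv ℝ v x := hv.continuous_fderiv one_ne_zero
  have cDg : Continuous fun x => fderiv ℝ g x := hg.continuous_fderiv one_ne_zero
  have cS : Continuous fun x => ∑ i, ⟪fderiv ℝ v x (e i), fderiv ℝ g x (e i)⟫ :=
    continuous_finsetSum _ fun i _ =>
      (cDv.clm_apply continuous_const).inner (cDg.clm_apply continuous_const)
  have cFv : Continuous fun x => frobeniusNormSq (fderiv ℝ v x) :=
    continuous_frobeniusNormSq_fderiv hv one_ne_zero
  have cFg : Continuous fun x => frobeniusNormSq (fderiv ℝ g x) :=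
    continuous_frobeniusNormSq_fderiv hg one_ne_zero
  -- the Frobenius norms are the basis sums
  have hFv : ∀ x, frobeniusNormSq (fderiv ℝ v x) = ∑ i, ‖fderiv ℝ v x (e i)‖ ^ 2 := fun x =>
    frobeniusNormSq_eq_sum e _
  have hFg : ∀ x, frobeniusNormSq (fderiv ℝ g x) = ∑ i, ‖fderiv ℝ g x (e i)‖ ^ 2 := fun x =>
    frobeniusNormSq_eq_sum e _
  -- `L²` facts
  have hDv_eq : ∀ x, ‖fderiv ℝ v x‖ = ‖iteratedFDeriv ℝ 1 v x‖ := fun x => by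
    rw [← norm_iteratedFDeriv_fderiv, norm_iteratedFDeriv_zero]
  have hDg_eq : ∀ x, ‖fderiv ℝ g x‖ = ‖iteratedFDeriv ℝ 1 g x‖ := fun x => by
    rw [← norm_iteratedFDeriv_fderiv, norm_iteratedFDeriv_zero]
  have l2Dv : ∫⁻ x, ‖fderiv ℝ v x‖ₑ ^ 2 < ⊤ :=
    lintegral_enorm_sq_lt_top_of_norm_le (fun x => (hDv_eq x).le) hv1
  have l2Dg : ∫⁻ x, ‖fderiv ℝ g x‖ₑ ^ 2 < ⊤ :=
    lintegral_enorm_sq_lt_top_of_norm_le (fun x => (hDg_eq x).le) hg1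
  have ifrob : ∀ {w : EuclideanSpace ℝ (Fin 3) → EuclideanSpace ℝ (Fin 3)}, ContDiff ℝ 1 w →
      ∫⁻ x, ‖fderiv ℝ w x‖ₑ ^ 2 < ⊤ →
      Integrable (fun x => frobeniusNormSq (fderiv ℝ w x)) volume := by
    intro w hw hw2
    have hlt : ∫⁻ x, ENNReal.ofReal (frobeniusNormSq (fderiv ℝ w x)) < ⊤ :=
      calc ∫⁻ x, ENNReal.ofReal (frobeniusNormSq (fderiv ℝ w x))
          ≤ ∫⁻ x, 3 * ‖fderiv ℝ w x‖ₑ ^ 2 :=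
            lintegral_mono fun x => ofReal_frobeniusNormSq_le_three_mul_enorm_sq _
        _ = 3 * ∫⁻ x, ‖fderiv ℝ w x‖ₑ ^ 2 := lintegral_const_mul' _ _ (by norm_num)
        _ < ⊤ := ENNReal.mul_lt_top (by norm_num) hw2
    exact integrable_of_continuous_of_nonneg (continuous_frobeniusNormSq_fderiv hw one_ne_zero)
      (fun x => frobeniusNormSq_nonneg _) hlt
  have iFv := ifrob hv l2Dv
  have iFg := ifrob hg l2Dg
  -- integrability of the density
  have hint : Integrable (fun x => ∑ i, ⟪fderiv ℝ v x (e i), fderiv ℝ g x (e i)⟫) volume := by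
    refine Integrable.mono' ((iFv.add iFg).div_const 2) cS.aestronglyMeasurable
      (Eventually.of_forall fun x => ?_)
    simp only [Pi.add_apply]
    rw [Real.norm_eq_abs, hFv x, hFg x]
    exact abs_sum_inner_le_half_add _ _ _
  refine ⟨hint, ?_⟩
  -- Cauchy–Schwarz, pointwise and in `L²`
  have hpt : ∀ x, ∑ i, ⟪fderiv ℝ v x (e i), fderiv ℝ g x (e i)⟫ ≤
      Real.sqrt (frobeniusNormSq (fderiv ℝ v x)) * Real.sqrt (frobeniusNormSq (fderiv ℝ g x)) := by
    intro x
    rw [hFv x, hFg x]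
    exact sum_inner_le_sqrt_mul_sqrt _ _ _
  have cP : Continuous fun x =>
      Real.sqrt (frobeniusNormSq (fderiv ℝ v x)) * Real.sqrt (frobeniusNormSq (fderiv ℝ g x)) :=
    (Real.continuous_sqrt.comp cFv).mul (Real.continuous_sqrt.comp cFg)
  have iP : Integrable (fun x =>
      Real.sqrt (frobeniusNormSq (fderiv ℝ v x)) * Real.sqrt (frobeniusNormSq (fderiv ℝ g x)))
      volume := by
    refine Integrable.mono' ((iFv.add iFg).div_const 2) cP.aestronglyMeasurable
      (Eventually.of_forall fun x => ?_)
    simp only [Pi.add_apply]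
    have ha := frobeniusNormSq_nonneg (fderiv ℝ v x)
    have hb := frobeniusNormSq_nonneg (fderiv ℝ g x)
    rw [Real.norm_of_nonneg (mul_nonneg (Real.sqrt_nonneg _) (Real.sqrt_nonneg _))]
    nlinarith [Real.sq_sqrt ha, Real.sq_sqrt hb, Real.sqrt_nonneg (frobeniusNormSq (fderiv ℝ v x)),
      Real.sqrt_nonneg (frobeniusNormSq (fderiv ℝ g x)),
      sq_nonneg (Real.sqrt (frobeniusNormSq (fderiv ℝ v x)) -
        Real.sqrt (frobeniusNormSq (fderiv ℝ g x)))]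
  have hCS := integral_mul_le_sqrt_mul_sqrt (μ := volume)
    (f := fun x => Real.sqrt (frobeniusNormSq (fderiv ℝ v x)))
    (g := fun x => Real.sqrt (frobeniusNormSq (fderiv ℝ g x)))
    (fun x => Real.sqrt_nonneg _) (fun x => Real.sqrt_nonneg _)
    (Real.continuous_sqrt.comp cFv).aestronglyMeasurable
    (Real.continuous_sqrt.comp cFg).aestronglyMeasurable
    (by simpa only [Real.sq_sqrt (frobeniusNormSq_nonneg _)] using iFv)
    (by simpa only [Real.sq_sqrt (frobeniusNormSq_nonneg _)] using iFg)
  simp only [Real.sq_sqrt (frobeniusNormSq_nonneg _)] at hCS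
  exact (integral_mono hint iP hpt).trans hCS

end Work

/-! ### The cubic enstrophy inequality with dissipation and work term on a slab -/

section Slab

set_option maxHeartbeats 1600000 in
/-- **The enstrophy inequality with dissipation, integrated in time, WITH FORCE** (Tao 2013, proof
of Thm. 5.4 (ii); Robinson–Rodrigo–Sadowski 2016, (6.7) with the work term:
`d/dt ‖∇u‖² + ν‖Δu‖² ≤ κν⁻³‖∇u‖⁶ + 2‖∇u‖₂‖∇f‖₂`, whole space, viscosity `ν`). There is an absolute
constant `κ > 0` such that for every classical solution `(u, p)` of the Navier–Stokes system with
force `f` on a closed slab `[0, T] × ℝ³` in the smooth `H¹` class (`u, ∂ₜu, p ∈ L^∞_t H^k_x` for all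
`k`) and every force `f` jointly smooth on the slab with uniform Schwartz bounds there, writing
`G(t) = ∫ |∇u(t)|²`, `G_f(t) = ∫|∇f(t)|²`: `G` and `G_f` are continuous on `[0, T]`,
`G(b) ≤ G(0) + ∫₀ᵇ (κ ν⁻³ G³ + 2 √G √G_f)` for every `b ∈ [0, T]`,
`ν ∫₀ᵀ ∫ ‖Δu‖² ≤ G(0) + ∫₀ᵀ (κ ν⁻³ G³ + 2 √G √G_f)` (lower integral in time), and (bookkeeping)
`G(t)`, `G_f(t)` are the lower integrals `∫⁻ |∇u(t)|²`, `∫⁻|∇f(t)|²`.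
Proof: the enstrophy balance (`IsSmoothSpaceTimeOn.enstrophy_balance`), the dissipative slice bound
`exists_slice_dissipative` applied with the modified time derivative `W = ∂ₜu − f` (for which
`W + (u·∇)u = νΔu − ∇p`), the work term `integral_sum_inner_fderiv_le_sqrt_mul_sqrt`, and Sobolev
`‖u‖_{L⁶} ≤ K ‖Du‖_{L²}`. [cite: Tao2011, Thm. 5.4 (ii) (arXiv Thm. 31, proof)] -/
theorem exists_enstrophy_cubic_ineq_forced :
    ∃ κ : ℝ, 0 < κ ∧ ∀ ⦃ν T : ℝ⦄ (_ : 0 < ν) (_ : 0 < T)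
      ⦃u f : ℝ → EuclideanSpace ℝ (Fin 3) → EuclideanSpace ℝ (Fin 3)⦄
      ⦃p : ℝ → EuclideanSpace ℝ (Fin 3) → ℝ⦄
      (_ : IsClassicalNSSolutionOn (Icc 0 T) ν f u p)
      (_ : HasBoundedSobolevNormsOn (Icc 0 T) u)
      (_ : HasBoundedSobolevNormsOn (Icc 0 T) (timeDerivWithin (Icc 0 T) u))
      (_ : ∀ n : ℕ, ∃ C : ℝ≥0, ∀ t ∈ Icc 0 T, ∫⁻ x, ‖iteratedFDeriv ℝ n (p t) x‖ₑ ^ 2 ≤ C)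
      (_ : IsSmoothSpaceTimeOn (Icc 0 T) f) (_ : HasUniformRapidDecayOn (Icc 0 T) f),
      ContinuousOn (fun t => ∫ x, frobeniusNormSq (fderiv ℝ (u t) x)) (Icc 0 T) ∧
      ContinuousOn (fun t => ∫ x, frobeniusNormSq (fderiv ℝ (f t) x)) (Icc 0 T) ∧
      (∀ b ∈ Icc 0 T, ∫ x, frobeniusNormSq (fderiv ℝ (u b) x) ≤
        (∫ x, frobeniusNormSq (fderiv ℝ (u 0) x)) +
          ∫ t in (0 : ℝ)..b, (κ * (ν ^ 3)⁻¹ * (∫ x, frobeniusNormSq (fderiv ℝ (u t) x)) ^ 3 +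
            2 * Real.sqrt (∫ x, frobeniusNormSq (fderiv ℝ (u t) x)) *
              Real.sqrt (∫ x, frobeniusNormSq (fderiv ℝ (f t) x)))) ∧
      ENNReal.ofReal ν * ∫⁻ t in Ioo 0 T, ∫⁻ x, ‖(Δ (u t)) x‖ₑ ^ 2 ≤
        ENNReal.ofReal ((∫ x, frobeniusNormSq (fderiv ℝ (u 0) x)) +
          ∫ t in (0 : ℝ)..T, (κ * (ν ^ 3)⁻¹ * (∫ x, frobeniusNormSq (fderiv ℝ (u t) x)) ^ 3 +
            2 * Real.sqrt (∫ x, frobeniusNormSq (fderiv ℝ (u t) x)) *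
              Real.sqrt (∫ x, frobeniusNormSq (fderiv ℝ (f t) x)))) ∧
      (∀ t ∈ Icc 0 T, ENNReal.ofReal (∫ x, frobeniusNormSq (fderiv ℝ (u t) x)) =
        ∫⁻ x, ENNReal.ofReal (frobeniusNormSq (fderiv ℝ (u t) x))) ∧
      (∀ t ∈ Icc 0 T, ENNReal.ofReal (∫ x, frobeniusNormSq (fderiv ℝ (f t) x)) =
        ∫⁻ x, ENNReal.ofReal (frobeniusNormSq (fderiv ℝ (f t) x))) := by
  obtain ⟨C, hC0, hslice⟩ := exists_slice_dissipative
  set K : ℝ≥0 := SNormLESNormFDerivOfEqConst (EuclideanSpace ℝ (Fin 3))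
    (volume : Measure (EuclideanSpace ℝ (Fin 3))) 2 with hK
  refine ⟨2 * C * (K : ℝ) ^ 4 + 1, by positivity, ?_⟩
  intro ν T hν hT u f p hsol hu hut hp hfS hfD
  set κ : ℝ := 2 * C * (K : ℝ) ^ 4 + 1 with hκ
  have hκ0 : 0 < κ := by positivity
  have hν3 : 0 < (ν ^ 3)⁻¹ := by positivity
  set e := EuclideanSpace.basisFun (Fin 3) ℝ with he
  have hU : UniqueDiffOn ℝ (Icc 0 T) := uniqueDiffOn_Icc hT
  set W : ℝ → EuclideanSpace ℝ (Fin 3) → EuclideanSpace ℝ (Fin 3) :=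
    timeDerivWithin (Icc 0 T) u with hW
  have hWsm : IsSmoothSpaceTimeOn (Icc 0 T) W := hsol.smooth_velocity.timeDerivWithin hU
  -- the modified time derivative `W' = ∂ₜu − f`
  set W' : ℝ → EuclideanSpace ℝ (Fin 3) → EuclideanSpace ℝ (Fin 3) :=
    fun t x => W t x - f t x with hW'
  have hW'sm : IsSmoothSpaceTimeOn (Icc 0 T) W' := hWsm.sub hfS
  have hmom' : ∀ t ∈ Icc 0 T, ∀ x,
      W' t x + convect (u t) (u t) x = ν • (Δ (u t)) x - gradient (p t) x := by
    intro t ht x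
    have h := hsol.momentum t ht x
    have h' : W t x + convect (u t) (u t) x = ν • (Δ (u t)) x - gradient (p t) x + f t x := by
      simpa [hW] using h
    simp only [hW']
    rw [sub_add_eq_add_sub, h']
    abel
  -- bounds of the class
  obtain ⟨B₀, hB₀⟩ := linfty_bound_of_hasBoundedSobolevNormsOn_holds
    (fun t ht => (hsol.contDiff_velocity ht).of_le (by norm_cast)) hu
  obtain ⟨C₀, hC₀⟩ := hu 0
  obtain ⟨C₁, hC₁⟩ := hu 1
  obtain ⟨D₂, hD₂⟩ := hu 2
  obtain ⟨D₃, hD₃⟩ := hu 3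
  obtain ⟨E₀, hE₀⟩ := hut 0
  obtain ⟨E₁, hE₁⟩ := hut 1
  obtain ⟨P₀, hP₀⟩ := hp 0
  obtain ⟨P₁, hP₁⟩ := hp 1
  obtain ⟨hfB, hfB'⟩ := hfD.hasBoundedSobolevNormsOn_Icc hfS hT
  obtain ⟨F₀, hF₀⟩ := hfB 0
  obtain ⟨F₁, hF₁⟩ := hfB 1
  obtain ⟨F₁', hF₁'⟩ := hfB' 1
  have hzero : ∀ {g : EuclideanSpace ℝ (Fin 3) → EuclideanSpace ℝ (Fin 3)} {C' : ℝ≥0},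
      (∫⁻ x, ‖iteratedFDeriv ℝ 0 g x‖ₑ ^ 2 ≤ C') → ∫⁻ x, ‖g x‖ₑ ^ 2 < ⊤ := by
    intro g C' h
    refine lt_of_le_of_lt ((le_of_eq (lintegral_congr fun x => ?_)).trans h) ENNReal.coe_lt_top
    rw [← ofReal_norm, ← ofReal_norm, norm_iteratedFDeriv_zero]
  have hzero' : ∀ {g : EuclideanSpace ℝ (Fin 3) → ℝ} {C' : ℝ≥0},
      (∫⁻ x, ‖iteratedFDeriv ℝ 0 g x‖ₑ ^ 2 ≤ C') → ∫⁻ x, ‖g x‖ₑ ^ 2 < ⊤ := by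
    intro g C' h
    refine lt_of_le_of_lt ((le_of_eq (lintegral_congr fun x => ?_)).trans h) ENNReal.coe_lt_top
    rw [← ofReal_norm, ← ofReal_norm, norm_iteratedFDeriv_zero]
  have hB₀0 : 0 ≤ B₀ := (norm_nonneg _).trans (hB₀ 0 ⟨le_rfl, hT.le⟩ 0)
  have hL2 : ∀ t ∈ Icc 0 T, eLpNorm (u t) 2 volume < ⊤ := fun t ht =>
    eLpNorm_two_lt_top_of_lintegral_enorm_sq_lt_top (hzero (hC₀ t ht))
  have hL6 : ∀ t ∈ Icc 0 T, eLpNorm (u t) 6 volume < ⊤ := fun t ht =>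
    eLpNorm_lt_top_of_bound_of_two hB₀0 (hB₀ t ht) (hzero (hC₀ t ht)) (by norm_num)
  -- slice regularity of `f t`, `W t`, `W' t`
  have hf1 : ∀ t ∈ Icc 0 T, ContDiff ℝ 1 (f t) := fun t ht =>
    (hfS.contDiff_slice ht).of_le (by norm_cast)
  have hW1 : ∀ t ∈ Icc 0 T, ContDiff ℝ 1 (W t) := fun t ht =>
    (hWsm.contDiff_slice ht).of_le (by norm_cast)
  have hW'1 : ∀ t ∈ Icc 0 T, ContDiff ℝ 1 (W' t) := fun t ht =>
    (hW'sm.contDiff_slice ht).of_le (by norm_cast)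
  have hu1 : ∀ t ∈ Icc 0 T, ContDiff ℝ 1 (u t) := fun t ht =>
    (hsol.contDiff_velocity ht).of_le (by norm_cast)
  have n1 : ∀ {g : EuclideanSpace ℝ (Fin 3) → EuclideanSpace ℝ (Fin 3)} (x),
      ‖fderiv ℝ g x‖ = ‖iteratedFDeriv ℝ 1 g x‖ := fun x => by
    rw [← norm_iteratedFDeriv_fderiv, norm_iteratedFDeriv_zero]
  have hDf : ∀ t ∈ Icc 0 T, ∫⁻ x, ‖fderiv ℝ (f t) x‖ₑ ^ 2 < ⊤ := fun t ht =>
    lintegral_enorm_sq_lt_top_of_norm_le (fun x => (n1 x).le) ((hF₁ t ht).trans_lt ENNReal.coe_lt_top)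
  have hDW : ∀ t ∈ Icc 0 T, ∫⁻ x, ‖fderiv ℝ (W t) x‖ₑ ^ 2 < ⊤ := fun t ht =>
    lintegral_enorm_sq_lt_top_of_norm_le (fun x => (n1 x).le) ((hE₁ t ht).trans_lt ENNReal.coe_lt_top)
  have hW'0 : ∀ t ∈ Icc 0 T, ∫⁻ x, ‖W' t x‖ₑ ^ 2 < ⊤ := by
    intro t ht
    refine lintegral_enorm_sq_lt_top_of_norm_le_add (b := W t) (c := f t) (fun x => ?_)
      (hW1 t ht).continuous.aestronglyMeasurable (hzero (hE₀ t ht)) (hzero (hF₀ t ht))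
    simp only [hW']
    exact norm_sub_le _ _
  have hW'D : ∀ t ∈ Icc 0 T, ∫⁻ x, ‖iteratedFDeriv ℝ 1 (W' t) x‖ₑ ^ 2 < ⊤ := by
    intro t ht
    refine lintegral_enorm_sq_lt_top_of_norm_le_add (b := fun x => fderiv ℝ (W t) x)
      (c := fun x => fderiv ℝ (f t) x) (fun x => ?_)
      ((hW1 t ht).continuous_fderiv one_ne_zero).aestronglyMeasurable (hDW t ht) (hDf t ht)
    rw [← n1 x]
    have hd : fderiv ℝ (W' t) x = fderiv ℝ (W t) x - fderiv ℝ (f t) x := by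
      simp only [hW']
      exact fderiv_fun_sub (((hW1 t ht).differentiable one_ne_zero) x)
        (((hf1 t ht).differentiable one_ne_zero) x)
    rw [hd]
    exact norm_sub_le _ _
  -- the enstrophy balances of `u` and of `f`; the functions `Φ`, `G`, `Gf`, `D` (opaque)
  obtain ⟨hΦint, hGcont, hGb⟩ := hsol.smooth_velocity.enstrophy_balance hT hC₁ hE₁
  obtain ⟨-, hGfcont, -⟩ := hfS.enstrophy_balance hT hF₁ hF₁'
  obtain ⟨Φ, hΦ⟩ : ∃ Φ : ℝ → ℝ,
      Φ = fun t => ∫ x, 2 * ∑ i, ⟪fderiv ℝ (u t) x (e i), fderiv ℝ (W t) x (e i)⟫ := ⟨_, rfl⟩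
  obtain ⟨G, hG⟩ : ∃ G : ℝ → ℝ,
      G = fun t => ∫ x, frobeniusNormSq (fderiv ℝ (u t) x) := ⟨_, rfl⟩
  obtain ⟨Gf, hGf⟩ : ∃ Gf : ℝ → ℝ,
      Gf = fun t => ∫ x, frobeniusNormSq (fderiv ℝ (f t) x) := ⟨_, rfl⟩
  obtain ⟨D, hD⟩ : ∃ D : ℝ → ℝ, D = fun t => ∫ x, ‖(Δ (u t)) x‖ ^ 2 := ⟨_, rfl⟩
  have hΦt : ∀ t, Φ t = ∫ x, 2 * ∑ i, ⟪fderiv ℝ (u t) x (e i), fderiv ℝ (W t) x (e i)⟫ :=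
    fun t => by rw [hΦ]
  have hGt : ∀ t, G t = ∫ x, frobeniusNormSq (fderiv ℝ (u t) x) := fun t => by rw [hG]
  have hGft : ∀ t, Gf t = ∫ x, frobeniusNormSq (fderiv ℝ (f t) x) := fun t => by rw [hGf]
  have hDt : ∀ t, D t = ∫ x, ‖(Δ (u t)) x‖ ^ 2 := fun t => by rw [hD]
  rw [← hΦ] at hΦint
  have hGcont0 := hGcont
  have hGfcont0 := hGfcont
  rw [← hG] at hGcont
  rw [← hGf] at hGfcont
  have hGb' : ∀ b ∈ Ioc 0 T, G b = G 0 + ∫ t in (0 : ℝ)..b, Φ t := by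
    intro b hb
    rw [hGt, hGt, hΦ]
    exact hGb b hb
  have hG0 : ∀ t, 0 ≤ G t := fun t => by
    rw [hGt]; exact integral_nonneg fun x => frobeniusNormSq_nonneg _
  have hGf0 : ∀ t, 0 ≤ Gf t := fun t => by
    rw [hGft]; exact integral_nonneg fun x => frobeniusNormSq_nonneg _
  have hD0 : ∀ t, 0 ≤ D t := fun t => by
    rw [hDt]; exact integral_nonneg fun x => sq_nonneg _
  -- the bound `g t := κ ν⁻³ G t ^ 3 + 2 √G √Gf`, continuous on the slab
  obtain ⟨g, hg⟩ : ∃ g : ℝ → ℝ,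
      g = fun t => κ * (ν ^ 3)⁻¹ * G t ^ 3 + 2 * Real.sqrt (G t) * Real.sqrt (Gf t) := ⟨_, rfl⟩
  have hgt : ∀ t, g t = κ * (ν ^ 3)⁻¹ * G t ^ 3 + 2 * Real.sqrt (G t) * Real.sqrt (Gf t) :=
    fun t => by rw [hg]
  have hgc : ContinuousOn g (Icc 0 T) := by
    rw [hg]
    exact (continuousOn_const.mul (hGcont.pow 3)).add
      ((continuousOn_const.mul (Real.continuous_sqrt.comp_continuousOn hGcont)).mul
        (Real.continuous_sqrt.comp_continuousOn hGfcont))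
  -- per-slice quantities
  have l2Dv : ∀ t ∈ Icc 0 T, ∫⁻ x, ‖fderiv ℝ (u t) x‖ₑ ^ 2 < ⊤ := fun t ht =>
    lintegral_enorm_sq_lt_top_of_norm_le (fun x => (n1 x).le) ((hC₁ t ht).trans_lt ENNReal.coe_lt_top)
  have ifrob : ∀ {w : EuclideanSpace ℝ (Fin 3) → EuclideanSpace ℝ (Fin 3)}, ContDiff ℝ 1 w →
      ∫⁻ x, ‖fderiv ℝ w x‖ₑ ^ 2 < ⊤ →
      Integrable (fun x => frobeniusNormSq (fderiv ℝ w x)) volume := by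
    intro w hw hw2
    have hlt : ∫⁻ x, ENNReal.ofReal (frobeniusNormSq (fderiv ℝ w x)) < ⊤ :=
      calc ∫⁻ x, ENNReal.ofReal (frobeniusNormSq (fderiv ℝ w x))
          ≤ ∫⁻ x, 3 * ‖fderiv ℝ w x‖ₑ ^ 2 :=
            lintegral_mono fun x => ofReal_frobeniusNormSq_le_three_mul_enorm_sq _
        _ = 3 * ∫⁻ x, ‖fderiv ℝ w x‖ₑ ^ 2 := lintegral_const_mul' _ _ (by norm_num)
        _ < ⊤ := ENNReal.mul_lt_top (by norm_num) hw2
    exact integrable_of_continuous_of_nonneg (continuous_frobeniusNormSq_fderiv hw one_ne_zero)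
      (fun x => frobeniusNormSq_nonneg _) hlt
  have iFu : ∀ t ∈ Icc 0 T, Integrable (fun x => frobeniusNormSq (fderiv ℝ (u t) x)) volume :=
    fun t ht => ifrob (hu1 t ht) (l2Dv t ht)
  have iFf : ∀ t ∈ Icc 0 T, Integrable (fun x => frobeniusNormSq (fderiv ℝ (f t) x)) volume :=
    fun t ht => ifrob (hf1 t ht) (hDf t ht)
  have iDv : ∀ t ∈ Icc 0 T, Integrable (fun x => ‖fderiv ℝ (u t) x‖ ^ 2) volume := fun t ht =>
    integrable_sq_norm_of_lintegral_lt_top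
      ((hsol.contDiff_velocity ht).continuous_fderiv (by simp)) (l2Dv t ht)
  have n_Δ : ∀ t ∈ Icc 0 T, ∀ x, ‖(Δ (u t)) x‖ ≤ ‖(3 : ℝ) • iteratedFDeriv ℝ 2 (u t) x‖ := by
    intro t ht x
    rw [norm_smul, Real.norm_of_nonneg (by norm_num : (0 : ℝ) ≤ 3)]
    exact norm_laplacian_le_three_mul_norm_iteratedFDeriv_two
      ((hsol.contDiff_velocity ht).of_le (by norm_cast)) x
  have l2Δ : ∀ t ∈ Icc 0 T, ∫⁻ x, ‖(Δ (u t)) x‖ₑ ^ 2 < ⊤ := fun t ht =>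
    lintegral_enorm_sq_lt_top_of_norm_le (n_Δ t ht)
      (lintegral_enorm_sq_const_smul_lt_top 3 ((hD₂ t ht).trans_lt ENNReal.coe_lt_top))
  have cΔ : ∀ t ∈ Icc 0 T, Continuous (Δ (u t)) := fun t ht =>
    (contDiff_one_laplacian_of_contDiff_three ((hsol.contDiff_velocity ht).of_le (by norm_cast))).continuous
  have iΔΔ : ∀ t ∈ Icc 0 T, Integrable (fun x => ‖(Δ (u t)) x‖ ^ 2) volume := fun t ht =>
    integrable_sq_norm_of_lintegral_lt_top (cΔ t ht) (l2Δ t ht)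
  -- Sobolev: `‖u(t)‖⁴_{L⁶} ≤ K⁴ G(t)²`
  have hSob : ∀ t ∈ Icc 0 T, (eLpNorm (u t) 6 volume).toReal ^ 4 ≤ (K : ℝ) ^ 4 * G t ^ 2 := by
    intro t ht
    set M : ℝ≥0∞ := eLpNorm (fderiv ℝ (u t)) 2 volume with hM
    have hMtop : M < ⊤ := eLpNorm_two_lt_top_of_lintegral_enorm_sq_lt_top (l2Dv t ht)
    have hS : eLpNorm (u t) 6 volume ≤ K * M :=
      eLpNorm_six_le_eLpNorm_fderiv_two volume finrank_euclideanSpace_fin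
        ((hsol.contDiff_velocity ht).of_le (by norm_cast)) (hL2 t ht)
    have hN : (eLpNorm (u t) 6 volume).toReal ≤ (K : ℝ) * M.toReal := by
      have h := ENNReal.toReal_mono (ENNReal.mul_ne_top ENNReal.coe_ne_top hMtop.ne) hS
      rwa [ENNReal.toReal_mul, ENNReal.coe_toReal] at h
    have hM2 : M.toReal ^ 2 ≤ G t := by
      have h1 : M.toReal ^ 2 = ∫ x, ‖fderiv ℝ (u t) x‖ ^ 2 := by
        rw [← ENNReal.toReal_pow, hM, ← lintegral_enorm_sq_eq_eLpNorm_two_sq,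
          ← ofReal_integral_sq_norm (iDv t ht), ENNReal.toReal_ofReal (integral_nonneg fun _ => sq_nonneg _)]
      rw [h1, hGt]
      exact integral_mono (iDv t ht) (iFu t ht) fun x => sq_opNorm_le_frobeniusNormSq _
    have hN0 : 0 ≤ (eLpNorm (u t) 6 volume).toReal := ENNReal.toReal_nonneg
    have hMr0 : 0 ≤ M.toReal := ENNReal.toReal_nonneg
    calc (eLpNorm (u t) 6 volume).toReal ^ 4 ≤ ((K : ℝ) * M.toReal) ^ 4 :=
          pow_le_pow_left₀ hN0 hN 4
      _ = (K : ℝ) ^ 4 * (M.toReal ^ 2) ^ 2 := by ring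
      _ ≤ (K : ℝ) ^ 4 * G t ^ 2 := by
          gcongr
  -- the split of the balance density: `Φ t = 2∫Σ⟪∂u, ∂W'⟫ + 2∫Σ⟪∂u, ∂f⟫`
  have hsplit : ∀ t ∈ Icc 0 T, Φ t =
      2 * (∫ x, ∑ i, ⟪fderiv ℝ (u t) x (e i), fderiv ℝ (W' t) x (e i)⟫) +
        2 * ∫ x, ∑ i, ⟪fderiv ℝ (u t) x (e i), fderiv ℝ (f t) x (e i)⟫ := by
    intro t ht
    have iA := (integral_sum_inner_fderiv_le_sqrt_mul_sqrt (hu1 t ht) (hW'1 t ht)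
      ((hC₁ t ht).trans_lt ENNReal.coe_lt_top) (hW'D t ht)).1
    have iB := (integral_sum_inner_fderiv_le_sqrt_mul_sqrt (hu1 t ht) (hf1 t ht)
      ((hC₁ t ht).trans_lt ENNReal.coe_lt_top) ((hF₁ t ht).trans_lt ENNReal.coe_lt_top)).1
    have hptW : ∀ x, fderiv ℝ (W t) x = fderiv ℝ (W' t) x + fderiv ℝ (f t) x := by
      intro x
      have hWW : W t = fun y => W' t y + f t y := by
        funext y; simp only [hW']; abel
      rw [hWW]
      exact fderiv_fun_add (((hW'1 t ht).differentiable one_ne_zero) x)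
        (((hf1 t ht).differentiable one_ne_zero) x)
    have hpt : ∀ x, 2 * ∑ i, ⟪fderiv ℝ (u t) x (e i), fderiv ℝ (W t) x (e i)⟫ =
        2 * ∑ i, ⟪fderiv ℝ (u t) x (e i), fderiv ℝ (W' t) x (e i)⟫ +
          2 * ∑ i, ⟪fderiv ℝ (u t) x (e i), fderiv ℝ (f t) x (e i)⟫ := by
      intro x
      rw [← mul_add, ← Finset.sum_add_distrib]
      congr 1
      refine Finset.sum_congr rfl fun i _ => ?_
      rw [hptW x, add_apply, inner_add_right]
    rw [hΦt, integral_congr_ae (Eventually.of_forall hpt), integral_add (iA.const_mul 2)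
      (iB.const_mul 2), integral_const_mul, integral_const_mul]
  -- the production bound at each time of the slab
  have hslab : ∀ t ∈ Icc 0 T, Φ t ≤ -ν * D t + g t := by
    intro t ht
    have hsl := hslice hν ((hsol.contDiff_velocity ht).of_le (by norm_cast))
      (hW'1 t ht) ((hsol.contDiff_pressure ht).of_le (by norm_cast)) (hmom' t ht)
      (hsol.divFree t ht) (fun x => hB₀ t ht x) (hL6 t ht)
      ((hC₁ t ht).trans_lt ENNReal.coe_lt_top) ((hD₂ t ht).trans_lt ENNReal.coe_lt_top)
      ((hD₃ t ht).trans_lt ENNReal.coe_lt_top)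
      (hW'0 t ht) (hW'D t ht)
      (hzero' (hP₀ t ht)) ((hP₁ t ht).trans_lt ENNReal.coe_lt_top)
    have hwork := (integral_sum_inner_fderiv_le_sqrt_mul_sqrt (hu1 t ht) (hf1 t ht)
      ((hC₁ t ht).trans_lt ENNReal.coe_lt_top) ((hF₁ t ht).trans_lt ENNReal.coe_lt_top)).2
    have hN4 := hSob t ht
    have hGnn := hG0 t
    have hprod : C * (ν ^ 3)⁻¹ * (eLpNorm (u t) 6 volume).toReal ^ 4 * G t ≤
        C * (ν ^ 3)⁻¹ * ((K : ℝ) ^ 4 * G t ^ 2) * G t := by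
      gcongr
    have hextra : 0 ≤ (ν ^ 3)⁻¹ * G t ^ 3 := mul_nonneg hν3.le (pow_nonneg hGnn 3)
    rw [← hGt t, ← hDt t] at hsl
    rw [← hGt t, ← hGft t] at hwork
    rw [hsplit t ht, hgt t, hκ]
    nlinarith [hsl, hprod, hextra, hwork]
  have hgΦ : ∀ t ∈ Icc 0 T, Φ t ≤ g t := fun t ht => by
    have h := hslab t ht
    have hνD : 0 ≤ ν * D t := mul_nonneg hν.le (hD0 t)
    linarith
  refine ⟨hGcont0, hGfcont0, ?_, ?_, fun t ht => ofReal_integral_eq_lintegral_ofReal (iFu t ht)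
    (Eventually.of_forall fun x => frobeniusNormSq_nonneg _),
    fun t ht => ofReal_integral_eq_lintegral_ofReal (iFf t ht)
    (Eventually.of_forall fun x => frobeniusNormSq_nonneg _)⟩
  · -- the cubic inequality `G(b) ≤ G(0) + ∫₀ᵇ g`
    simp only [← hGt, ← hGft]
    intro b hb
    simp only [← hgt]
    rcases eq_or_lt_of_le hb.1 with hb0 | hb0
    · rw [← hb0, intervalIntegral.integral_same, add_zero]
    have hΦii : IntervalIntegrable Φ volume 0 b :=
      (intervalIntegrable_iff_integrableOn_Ioo_of_le hb0.le).2
        (hΦint.mono_set (Ioo_subset_Ioo le_rfl hb.2))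
    have hgii : IntervalIntegrable g volume 0 b :=
      (hgc.mono (Icc_subset_Icc le_rfl hb.2)).intervalIntegrable_of_Icc hb0.le
    have hmono : ∫ t in (0 : ℝ)..b, Φ t ≤ ∫ t in (0 : ℝ)..b, g t :=
      intervalIntegral.integral_mono_on hb0.le hΦii hgii fun t ht =>
        hgΦ t ⟨ht.1, ht.2.trans hb.2⟩
    rw [hGb' b ⟨hb0, hb.2⟩]
    linarith
  · -- the dissipation bound (lower integral in time)
    simp only [← hGt, ← hGft]
    simp only [← hgt]
    obtain ⟨h, hh⟩ : ∃ h : ℝ → ℝ, h = fun t => g t - Φ t := ⟨_, rfl⟩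
    have hpt : ∀ t ∈ Ioo 0 T,
        ENNReal.ofReal ν * ∫⁻ x, ‖(Δ (u t)) x‖ₑ ^ 2 ≤ ENNReal.ofReal (h t) := by
      intro t ht
      have htI : t ∈ Icc 0 T := Ioo_subset_Icc_self ht
      rw [← ofReal_integral_sq_norm (iΔΔ t htI), ← ENNReal.ofReal_mul hν.le, ← hDt]
      refine ENNReal.ofReal_le_ofReal ?_
      have h1 := hslab t htI
      rw [hh]
      linarith
    have hhnn : ∀ t ∈ Ioo 0 T, 0 ≤ h t := fun t ht => by
      have h1 := hgΦ t (Ioo_subset_Icc_self ht)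
      rw [hh]
      linarith
    have hgint : IntegrableOn g (Ioo 0 T) volume :=
      (hgc.integrableOn_compact isCompact_Icc).mono_set Ioo_subset_Icc_self
    have hhint : IntegrableOn h (Ioo 0 T) volume := by rw [hh]; exact hgint.sub hΦint
    have hh_ae : 0 ≤ᵐ[volume.restrict (Ioo 0 T)] h :=
      (ae_restrict_iff' measurableSet_Ioo).2 (Eventually.of_forall fun t ht => hhnn t ht)
    -- `∫_{(0,T)} Φ = G T - G 0`
    have hΦT : ∫ t in Ioo 0 T, Φ t = G T - G 0 := by
      have h1 := hGb' T ⟨hT, le_rfl⟩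
      rw [intervalIntegral.integral_of_le hT.le, integral_Ioc_eq_integral_Ioo] at h1
      rw [h1]
      ring
    have hgT : ∫ t in Ioo 0 T, g t = ∫ t in (0 : ℝ)..T, g t := by
      rw [intervalIntegral.integral_of_le hT.le, integral_Ioc_eq_integral_Ioo]
    have hstep1 : ENNReal.ofReal ν * ∫⁻ t in Ioo 0 T, ∫⁻ x, ‖(Δ (u t)) x‖ₑ ^ 2 ≤
        ∫⁻ t in Ioo 0 T, ENNReal.ofReal (h t) := by
      rw [← lintegral_const_mul' _ _ ENNReal.ofReal_ne_top]
      exact setLIntegral_mono' measurableSet_Ioo hpt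
    have hstep2 : ∫⁻ t in Ioo 0 T, ENNReal.ofReal (h t) = ENNReal.ofReal (∫ t in Ioo 0 T, h t) :=
      (ofReal_integral_eq_lintegral_ofReal hhint hh_ae).symm
    have hstep3 : ∫ t in Ioo 0 T, h t ≤ G 0 + ∫ t in (0 : ℝ)..T, g t := by
      rw [hh, integral_sub hgint hΦint, hΦT, hgT]
      linarith [hG0 T]
    exact hstep1.trans (hstep2.le.trans (ENNReal.ofReal_le_ofReal hstep3))

end Slab

/-! ### The continuity argument and the a priori bound -/

section Bootstrap

/-- `exp (1/9) ≤ 9/8` (from `1 + x ≤ eˣ` at `x = -1/9`). [folklore] -/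
private theorem exp_one_div_nine_le : Real.exp (1 / 9 : ℝ) ≤ 9 / 8 := by
  have h := Real.add_one_le_exp (-(1 / 9 : ℝ))
  have hpos : 0 < Real.exp (-(1 / 9 : ℝ)) := Real.exp_pos _
  have h1 : Real.exp (1 / 9 : ℝ) = (Real.exp (-(1 / 9 : ℝ)))⁻¹ := by
    rw [Real.exp_neg, inv_inv]
  rw [h1, inv_le_comm₀ hpos (by norm_num)]
  norm_num at h ⊢
  linarith

/-- **Continuity method for the forced cubic inequality** (Robinson–Rodrigo–Sadowski 2016,
(6.8)–(6.9), with the work term; Tao 2013, proof of Thm. 5.4 (ii)). Let `G, G_f ≥ 0` be continuous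
on `[0, T]` with `G(b) ≤ G(0) + ∫₀ᵇ (L G³ + 2 √G √G_f)` for `b ∈ [0, T]` (`L > 0`), `G(0) ≤ A`,
`∫₀ᵀ √G_f ≤ B`, `M = √A + B > 0` and `729 L M⁴ T ≤ 1`. Then `G ≤ 8 M²` on `[0, T]`: under the
bootstrap hypothesis `G ≤ 9M²` on `[0, t]` the inequality is linear,
`G(t) ≤ G(0) + ∫₀ᵗ (81 L M⁴ G + 6 M √G_f)`, and the tree's `bootstrap_gronwall_integral` closes since
`e^{81 L M⁴ T}(A + 6MB) ≤ (9/8) · 7M² < 9M²`.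
[cite: RobinsonRodrigoSadowski2016, Thm. 6.8 (proof, (6.8)-(6.9))] -/
theorem cubic_bootstrap_forced {T L A B : ℝ} (hT : 0 < T) (hL : 0 < L) (hA : 0 ≤ A) (hB : 0 ≤ B)
    {G Gf : ℝ → ℝ} (hGc : ContinuousOn G (Icc 0 T)) (hGfc : ContinuousOn Gf (Icc 0 T))
    (hG0 : ∀ t, 0 ≤ G t)
    (hineq : ∀ b ∈ Icc 0 T, G b ≤ G 0 + ∫ t in (0 : ℝ)..b,
      (L * G t ^ 3 + 2 * Real.sqrt (G t) * Real.sqrt (Gf t)))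
    (hGA : G 0 ≤ A) (hBf : ∫ t in (0 : ℝ)..T, Real.sqrt (Gf t) ≤ B)
    (hMpos : 0 < Real.sqrt A + B) (hsmall : 729 * L * (Real.sqrt A + B) ^ 4 * T ≤ 1) :
    ∀ t ∈ Icc 0 T, G t ≤ 8 * (Real.sqrt A + B) ^ 2 := by
  set M : ℝ := Real.sqrt A + B with hM
  have hM0 : 0 < M := hMpos
  have hAM : A ≤ M ^ 2 := by
    have h1 : Real.sqrt A ≤ M := le_add_of_nonneg_right hB
    calc A = Real.sqrt A ^ 2 := (Real.sq_sqrt hA).symm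
      _ ≤ M ^ 2 := pow_le_pow_left₀ (Real.sqrt_nonneg _) h1 2
  have hBM : B ≤ M := le_add_of_nonneg_left (Real.sqrt_nonneg _)
  set κ : ℝ := 81 * L * M ^ 4 with hκ
  have hκ0 : 0 < κ := by positivity
  set g : ℝ → ℝ := fun s => 6 * M * Real.sqrt (Gf s) with hg
  have hsqc : ContinuousOn (fun t => Real.sqrt (Gf t)) (Icc 0 T) :=
    Real.continuous_sqrt.comp_continuousOn hGfc
  have hgc : ContinuousOn g (Icc 0 T) := continuousOn_const.mul hsqc
  have hg0 : ∀ t ∈ Icc 0 T, 0 ≤ g t := fun t _ => by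
    simp only [hg]; exact mul_nonneg (by positivity) (Real.sqrt_nonneg _)
  have hsq3 : Real.sqrt (9 * M ^ 2) = 3 * M := by
    rw [show (9 : ℝ) * M ^ 2 = (3 * M) ^ 2 by ring, Real.sqrt_sq (by positivity)]
  -- the linear inequality under the bootstrap hypothesis
  have hlin : ∀ t ∈ Icc 0 T, (∀ s ∈ Icc 0 t, G s ≤ 9 * M ^ 2) →
      G t ≤ G 0 + ∫ s in (0 : ℝ)..t, (κ * G s + g s) := by
    intro t ht hboot
    rcases eq_or_lt_of_le ht.1 with ht0 | ht0
    · rw [← ht0, intervalIntegral.integral_same, add_zero]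
    have hGc' : ContinuousOn G (Icc 0 t) := hGc.mono (Icc_subset_Icc le_rfl ht.2)
    have hGfc' : ContinuousOn Gf (Icc 0 t) := hGfc.mono (Icc_subset_Icc le_rfl ht.2)
    have hii1 : IntervalIntegrable (fun s => L * G s ^ 3 + 2 * Real.sqrt (G s) * Real.sqrt (Gf s))
        volume 0 t :=
      ((continuousOn_const.mul (hGc'.pow 3)).add
        ((continuousOn_const.mul (Real.continuous_sqrt.comp_continuousOn hGc')).mul
          (Real.continuous_sqrt.comp_continuousOn hGfc'))).intervalIntegrable_of_Icc ht0.le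
    have hii2 : IntervalIntegrable (fun s => κ * G s + g s) volume 0 t :=
      ((continuousOn_const.mul hGc').add (hgc.mono (Icc_subset_Icc le_rfl ht.2))).intervalIntegrable_of_Icc ht0.le
    have hmono : ∫ s in (0 : ℝ)..t, (L * G s ^ 3 + 2 * Real.sqrt (G s) * Real.sqrt (Gf s)) ≤
        ∫ s in (0 : ℝ)..t, (κ * G s + g s) := by
      refine intervalIntegral.integral_mono_on ht0.le hii1 hii2 fun s hs => ?_
      have hGs := hboot s hs
      have hGs0 := hG0 s
      have h1 : G s ^ 3 ≤ (9 * M ^ 2) ^ 2 * G s := by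
        have h2 : G s ^ 2 ≤ (9 * M ^ 2) ^ 2 := pow_le_pow_left₀ hGs0 hGs 2
        calc G s ^ 3 = G s ^ 2 * G s := by ring
          _ ≤ (9 * M ^ 2) ^ 2 * G s := mul_le_mul_of_nonneg_right h2 hGs0
      have h2 : Real.sqrt (G s) ≤ 3 * M := by rw [← hsq3]; exact Real.sqrt_le_sqrt hGs
      have h3 : 0 ≤ Real.sqrt (Gf s) := Real.sqrt_nonneg _
      simp only [hg, hκ]
      nlinarith [mul_le_mul_of_nonneg_left h1 hL.le, mul_le_mul_of_nonneg_right h2 h3]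
    exact (hineq t ht).trans (by linarith)
  -- the size of the Grönwall bound
  have hΓ : ∫ s in (0 : ℝ)..T, g s ≤ 6 * M * B := by
    simp only [hg]
    rw [intervalIntegral.integral_const_mul]
    exact mul_le_mul_of_nonneg_left hBf (by positivity)
  have hexp : Real.exp (κ * T) ≤ 9 / 8 := by
    have h1 : κ * T ≤ 1 / 9 := by
      have : κ * T = (729 * L * M ^ 4 * T) / 9 := by simp only [hκ]; ring
      rw [this]; linarith
    exact (Real.exp_le_exp.2 h1).trans exp_one_div_nine_le
  have hsum : G 0 + ∫ s in (0 : ℝ)..T, g s ≤ 7 * M ^ 2 := by nlinarith [hGA, hAM, hΓ, hBM, hM0]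
  have hsum0 : 0 ≤ G 0 + ∫ s in (0 : ℝ)..T, g s :=
    add_nonneg (hG0 0) (intervalIntegral.integral_nonneg hT.le fun s hs => hg0 s hs)
  have hbound : Real.exp (κ * T) * (G 0 + ∫ s in (0 : ℝ)..T, g s) ≤ 63 / 8 * M ^ 2 :=
    calc Real.exp (κ * T) * (G 0 + ∫ s in (0 : ℝ)..T, g s) ≤ (9 / 8) * (7 * M ^ 2) :=
          mul_le_mul hexp hsum hsum0 (by norm_num)
      _ = 63 / 8 * M ^ 2 := by ring
  have hMB : Real.exp (κ * T) * (G 0 + ∫ s in (0 : ℝ)..T, g s) < 9 * M ^ 2 :=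
    hbound.trans_lt (by nlinarith [hM0])
  have h := bootstrap_gronwall_integral hT hκ0 hGc hgc hg0 (hG0 0) hlin hMB
  intro t ht
  exact (h t ht).trans (hbound.trans (by nlinarith [hM0]))

/-- **The enstrophy a priori bound with lifespan, WITH FORCE, explicit constants** (Tao 2013,
Thm. 5.4 (ii): the `X¹` bound `‖u‖_{X¹([0,T])} ≲ ‖u₀‖_{H¹} + ‖f‖_{L¹_t H¹_x}` under
`(‖u₀‖_{H¹} + ‖f‖_{L¹_t H¹_x})⁴ T ≤ c`, gradient part, viscosity `ν` by the footnote-3 rescaling;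
Robinson–Rodrigo–Sadowski 2016, (6.6)–(6.10) and Cor. 6.9 with a force): there are absolute
constants `c, K > 0` such that for every classical solution `(u, p)` of the Navier–Stokes system
with force `f` on `[0, T] × ℝ³` in the smooth `H¹` class (`u, ∂ₜu, p ∈ L^∞_t H^k_x`), every force
`f` jointly smooth on the slab with uniform Schwartz bounds there, and all `A, B ≥ 0` with
`∫|∇u(0)|² ≤ A`, `∫₀ᵀ ‖∇f(t)‖₂ dt ≤ B` and `(√A + B)⁴ T ≤ c ν³`: `∫|∇u(t)|² ≤ K (√A + B)²` for all
`t ∈ [0, T]` and `ν ∫₀ᵀ∫‖D²u‖² ≤ K (√A + B)²` (here `c = 1/(729κ)`, `K = 216`, `κ` the constant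
of `exists_enstrophy_cubic_ineq_forced`). For `f = 0`, `B = 0` this is the homogeneous
`exists_leray_enstrophy_apriori` up to the constants.
[cite: Tao2011, Thm. 5.4 (ii) (arXiv Thm. 31)] -/
theorem exists_leray_enstrophy_apriori_forced :
    ∃ c K : ℝ, 0 < c ∧ 0 < K ∧ ∀ ⦃ν T : ℝ⦄ (_ : 0 < ν) (_ : 0 < T)
      ⦃u f : ℝ → EuclideanSpace ℝ (Fin 3) → EuclideanSpace ℝ (Fin 3)⦄
      ⦃p : ℝ → EuclideanSpace ℝ (Fin 3) → ℝ⦄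
      (_ : IsClassicalNSSolutionOn (Icc 0 T) ν f u p)
      (_ : HasBoundedSobolevNormsOn (Icc 0 T) u)
      (_ : HasBoundedSobolevNormsOn (Icc 0 T) (timeDerivWithin (Icc 0 T) u))
      (_ : ∀ n : ℕ, ∃ C : ℝ≥0, ∀ t ∈ Icc 0 T, ∫⁻ x, ‖iteratedFDeriv ℝ n (p t) x‖ₑ ^ 2 ≤ C)
      (_ : IsSmoothSpaceTimeOn (Icc 0 T) f) (_ : HasUniformRapidDecayOn (Icc 0 T) f)
      ⦃A B : ℝ⦄ (_ : 0 ≤ A) (_ : 0 ≤ B)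
      (_ : (∫⁻ x, ENNReal.ofReal (frobeniusNormSq (fderiv ℝ (u 0) x))) ≤ ENNReal.ofReal A)
      (_ : ∫ t in (0 : ℝ)..T, Real.sqrt (∫ x, frobeniusNormSq (fderiv ℝ (f t) x)) ≤ B)
      (_ : (Real.sqrt A + B) ^ 4 * T ≤ c * ν ^ 3),
      (∀ t ∈ Icc 0 T, (∫⁻ x, ENNReal.ofReal (frobeniusNormSq (fderiv ℝ (u t) x))) ≤
          ENNReal.ofReal (K * (Real.sqrt A + B) ^ 2)) ∧
        ENNReal.ofReal ν * ∫⁻ t in Ioo 0 T, ∫⁻ x, ‖iteratedFDeriv ℝ 2 (u t) x‖ₑ ^ 2 ≤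
          ENNReal.ofReal (K * (Real.sqrt A + B) ^ 2) := by
  obtain ⟨κ, hκ, hcubic⟩ := exists_enstrophy_cubic_ineq_forced
  refine ⟨(729 * κ)⁻¹, 216, by positivity, by norm_num, ?_⟩
  intro ν T hν hT u f p hsol hu hut hp hfS hfD A B hA0 hB0 h0 hBf hsmall
  obtain ⟨hGc, hGfc, hineq, hdiss, hGeq, -⟩ := hcubic hν hT hsol hu hut hp hfS hfD
  obtain ⟨G, hG⟩ : ∃ G : ℝ → ℝ,
      G = fun t => ∫ x, frobeniusNormSq (fderiv ℝ (u t) x) := ⟨_, rfl⟩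
  obtain ⟨Gf, hGf⟩ : ∃ Gf : ℝ → ℝ,
      Gf = fun t => ∫ x, frobeniusNormSq (fderiv ℝ (f t) x) := ⟨_, rfl⟩
  have hGt : ∀ t, G t = ∫ x, frobeniusNormSq (fderiv ℝ (u t) x) := fun t => by rw [hG]
  have hGft : ∀ t, Gf t = ∫ x, frobeniusNormSq (fderiv ℝ (f t) x) := fun t => by rw [hGf]
  rw [← hG] at hGc
  rw [← hGf] at hGfc
  simp only [← hGt, ← hGft] at hineq hdiss hGeq hBf
  set L : ℝ := κ * (ν ^ 3)⁻¹ with hL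
  have hL0 : 0 < L := by positivity
  have hG0 : ∀ t, 0 ≤ G t := fun t => by
    rw [hGt]; exact integral_nonneg fun x => frobeniusNormSq_nonneg _
  have hGf0 : ∀ t, 0 ≤ Gf t := fun t => by
    rw [hGft]; exact integral_nonneg fun x => frobeniusNormSq_nonneg _
  set M : ℝ := Real.sqrt A + B with hM
  have hM0 : 0 ≤ M := add_nonneg (Real.sqrt_nonneg _) hB0
  -- `G 0 ≤ A`
  have hGA : G 0 ≤ A := by
    have h := h0
    rw [← hGeq 0 ⟨le_rfl, hT.le⟩] at h
    exact (ENNReal.ofReal_le_ofReal_iff hA0).1 h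
  -- the smallness condition: `729 L M⁴ T ≤ 1`
  have hsm : 729 * L * M ^ 4 * T ≤ 1 := by
    have hν3 : 0 < ν ^ 3 := by positivity
    calc 729 * L * M ^ 4 * T = (729 * κ / ν ^ 3) * (M ^ 4 * T) := by rw [hL]; ring
      _ ≤ (729 * κ / ν ^ 3) * ((729 * κ)⁻¹ * ν ^ 3) :=
          mul_le_mul_of_nonneg_left hsmall (by positivity)
      _ = 1 := by field_simp
  -- the uniform bound `G ≤ 8 M²` on `[0, T]`
  have hsup : ∀ t ∈ Icc 0 T, G t ≤ 8 * M ^ 2 := by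
    rcases eq_or_lt_of_le hM0 with hMz | hMpos
    · -- degenerate case `M = 0`: then `A = 0`, `B = 0`, and `G ≤ 8δ` for every small `δ > 0`
      have hA : A = 0 := by
        have h1 : Real.sqrt A = 0 := by linarith [Real.sqrt_nonneg A, hMz.symm.le, hM]
        rwa [Real.sqrt_eq_zero hA0] at h1
      have hB : B = 0 := by linarith [Real.sqrt_nonneg A, hMz.symm.le, hM]
      intro t ht
      rw [← hMz]
      have hGt0 : G t ≤ 0 := by
        refine le_of_forall_pos_le_add fun δ hδ => ?_
        -- apply the bootstrap with `A' = δ' := min δ' …` small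
        set δ' : ℝ := min (δ / 8) (1 / (729 * L * T + 1)) with hδ'
        have hδ'pos : 0 < δ' := lt_min (by linarith) (by positivity)
        have hδ'1 : δ' ≤ δ / 8 := min_le_left _ _
        have hδ'2 : δ' ≤ 1 / (729 * L * T + 1) := min_le_right _ _
        have hδ'le1 : δ' ≤ 1 := hδ'2.trans (by
          rw [div_le_one (by positivity)]; linarith [mul_pos (mul_pos (by norm_num : (0:ℝ) < 729) hL0) hT])
        have hsmall' : 729 * L * (Real.sqrt δ' + B) ^ 4 * T ≤ 1 := by
          rw [hB, add_zero, show (4 : ℕ) = 2 * 2 from rfl, pow_mul, Real.sq_sqrt hδ'pos.le]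
          have h1 : δ' ^ 2 ≤ δ' := by nlinarith
          have h2 : 729 * L * T * δ' ≤ 729 * L * T * (1 / (729 * L * T + 1)) :=
            mul_le_mul_of_nonneg_left hδ'2 (by positivity)
          have h3 : 729 * L * T * (1 / (729 * L * T + 1)) ≤ 1 := by
            rw [mul_one_div, div_le_one (by positivity)]; linarith
          calc 729 * L * δ' ^ 2 * T = 729 * L * T * δ' ^ 2 := by ring
            _ ≤ 729 * L * T * δ' := mul_le_mul_of_nonneg_left h1 (by positivity)
            _ ≤ 1 := h2.trans h3
        have hpos' : 0 < Real.sqrt δ' + B := by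
          rw [hB, add_zero]; exact Real.sqrt_pos.2 hδ'pos
        have hGA' : G 0 ≤ δ' := by linarith [hGA, hA]
        have h := cubic_bootstrap_forced hT hL0 hδ'pos.le hB0 hGc hGfc hG0 hineq hGA' hBf hpos'
          hsmall' t ht
        rw [hB, add_zero, Real.sq_sqrt hδ'pos.le] at h
        linarith
      simpa using hGt0
    · exact cubic_bootstrap_forced hT hL0 hA0 hB0 hGc hGfc hG0 hineq hGA hBf hMpos hsm
  refine ⟨fun t ht => ?_, ?_⟩
  · -- the enstrophy bound
    rw [← hGeq t ht]
    exact ENNReal.ofReal_le_ofReal (by nlinarith [hsup t ht, sq_nonneg M])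
  · -- the dissipation bound
    have hsq8 : ∀ t ∈ Icc 0 T, Real.sqrt (G t) ≤ 3 * M := by
      intro t ht
      have h1 : G t ≤ (3 * M) ^ 2 := by nlinarith [hsup t ht, sq_nonneg M]
      calc Real.sqrt (G t) ≤ Real.sqrt ((3 * M) ^ 2) := Real.sqrt_le_sqrt h1
        _ = 3 * M := Real.sqrt_sq (by positivity)
    have hsqc : ContinuousOn (fun t => Real.sqrt (Gf t)) (Icc 0 T) :=
      Real.continuous_sqrt.comp_continuousOn hGfc
    have hii1 : IntervalIntegrable (fun t => L * G t ^ 3 + 2 * Real.sqrt (G t) * Real.sqrt (Gf t))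
        volume 0 T :=
      ((continuousOn_const.mul (hGc.pow 3)).add
        ((continuousOn_const.mul (Real.continuous_sqrt.comp_continuousOn hGc)).mul hsqc)).intervalIntegrable_of_Icc hT.le
    have hii2 : IntervalIntegrable (fun t => L * (8 * M ^ 2) ^ 3 + 6 * M * Real.sqrt (Gf t))
        volume 0 T :=
      (continuousOn_const.add (continuousOn_const.mul hsqc)).intervalIntegrable_of_Icc hT.le
    have hg3 : ∫ t in (0 : ℝ)..T, (L * G t ^ 3 + 2 * Real.sqrt (G t) * Real.sqrt (Gf t)) ≤
        ∫ t in (0 : ℝ)..T, (L * (8 * M ^ 2) ^ 3 + 6 * M * Real.sqrt (Gf t)) := by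
      refine intervalIntegral.integral_mono_on hT.le hii1 hii2 fun t ht => ?_
      have h1 : G t ^ 3 ≤ (8 * M ^ 2) ^ 3 := pow_le_pow_left₀ (hG0 t) (hsup t ht) 3
      have h2 := hsq8 t ht
      have h3 : 0 ≤ Real.sqrt (Gf t) := Real.sqrt_nonneg _
      nlinarith [mul_le_mul_of_nonneg_left h1 hL0.le, mul_le_mul_of_nonneg_right h2 h3]
    have hi6 : IntervalIntegrable (fun t => 6 * M * Real.sqrt (Gf t)) volume 0 T :=
      (continuousOn_const.mul hsqc).intervalIntegrable_of_Icc hT.le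
    have heval : ∫ t in (0 : ℝ)..T, (L * (8 * M ^ 2) ^ 3 + 6 * M * Real.sqrt (Gf t)) =
        T * (L * (8 * M ^ 2) ^ 3) + 6 * M * ∫ t in (0 : ℝ)..T, Real.sqrt (Gf t) := by
      rw [intervalIntegral.integral_add intervalIntegrable_const hi6,
        intervalIntegral.integral_const, intervalIntegral.integral_const_mul, sub_zero, smul_eq_mul]
    have hAM : A ≤ M ^ 2 := by
      have h1 : Real.sqrt A ≤ M := le_add_of_nonneg_right hB0
      calc A = Real.sqrt A ^ 2 := (Real.sq_sqrt hA0).symm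
        _ ≤ M ^ 2 := pow_le_pow_left₀ (Real.sqrt_nonneg _) h1 2
    have hBM : B ≤ M := le_add_of_nonneg_left (Real.sqrt_nonneg _)
    have hTL : T * (L * (8 * M ^ 2) ^ 3) ≤ M ^ 2 := by
      have : T * (L * (8 * M ^ 2) ^ 3) = (512 / 729) * (729 * L * M ^ 4 * T) * M ^ 2 := by ring
      rw [this]
      nlinarith [hsm, sq_nonneg M, mul_nonneg (mul_nonneg (mul_nonneg (by norm_num : (0:ℝ) ≤ 729) hL0.le) (pow_nonneg hM0 4)) hT.le]
    have hbound : G 0 + ∫ t in (0 : ℝ)..T, (L * G t ^ 3 + 2 * Real.sqrt (G t) * Real.sqrt (Gf t)) ≤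
        8 * M ^ 2 := by
      have h6 : 6 * M * ∫ t in (0 : ℝ)..T, Real.sqrt (Gf t) ≤ 6 * M * B :=
        mul_le_mul_of_nonneg_left hBf (by positivity)
      nlinarith [hGA, hAM, hg3, heval, hTL, h6, hBM, hM0]
    obtain ⟨C₁, hC₁⟩ := hu 1
    obtain ⟨D₂, hD₂⟩ := hu 2
    obtain ⟨D₃, hD₃⟩ := hu 3
    have hD2 : ∫⁻ t in Ioo 0 T, ∫⁻ x, ‖iteratedFDeriv ℝ 2 (u t) x‖ₑ ^ 2 ≤
        27 * ∫⁻ t in Ioo 0 T, ∫⁻ x, ‖(Δ (u t)) x‖ₑ ^ 2 := by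
      rw [← lintegral_const_mul' _ _ (by norm_num)]
      refine setLIntegral_mono' measurableSet_Ioo fun t ht => ?_
      have htI : t ∈ Icc 0 T := Ioo_subset_Icc_self ht
      exact lintegral_iteratedFDeriv_two_le_laplacian (hsol.contDiff_velocity htI)
        ((hC₁ t htI).trans_lt ENNReal.coe_lt_top) ((hD₂ t htI).trans_lt ENNReal.coe_lt_top)
        ((hD₃ t htI).trans_lt ENNReal.coe_lt_top)
    calc ENNReal.ofReal ν * ∫⁻ t in Ioo 0 T, ∫⁻ x, ‖iteratedFDeriv ℝ 2 (u t) x‖ₑ ^ 2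
        ≤ ENNReal.ofReal ν * (27 * ∫⁻ t in Ioo 0 T, ∫⁻ x, ‖(Δ (u t)) x‖ₑ ^ 2) := by gcongr
      _ = 27 * (ENNReal.ofReal ν * ∫⁻ t in Ioo 0 T, ∫⁻ x, ‖(Δ (u t)) x‖ₑ ^ 2) := by ring
      _ ≤ 27 * ENNReal.ofReal (G 0 + ∫ t in (0 : ℝ)..T,
            (L * G t ^ 3 + 2 * Real.sqrt (G t) * Real.sqrt (Gf t))) := by gcongr
      _ ≤ 27 * ENNReal.ofReal (8 * M ^ 2) := by gcongr
      _ = ENNReal.ofReal (216 * M ^ 2) := by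
          rw [← ENNReal.ofReal_ofNat 27, ← ENNReal.ofReal_mul (by norm_num)]
          congr 1
          ring

end Bootstrap

end Literature.Analysis.FluidPDE

end
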